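import Mathlib
import Literature.Geometry.Lorentzian.ReggeWheelerChannels

/-!
# Kernel-one far channels, VII: globalizing a half-plane solution by a spatial cutoff

Helper file for `stub_kernelOneChannels` of line `crum-peeling-recessive-tower` (crux
`UniformPhotonSphereChannelsR`, stmt-FinalStateConjecture-14074).  The stub is stated for a
potential `Q ∈ C¹(a, ∞)` and a solution `φ` of `φ_tt − φ_xx + Qφ = 0` which is `C²` only on the open
half-plane `{x > a}`, while the 1+1 wave-equation infrastructure (`Literature/Analysis/PDE/Wave1D*`)
takes global `C²` functions.  A smooth cutoff `χ` with `χ = 0` on `(−∞, a₁]` and `χ = 1` on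
`[a₂, ∞)` (`a < a₁ < a₂ < x_f`, `exists_cutoff`) globalizes everything without changing anything on
the far region `{x > a₂}`:

* `contDiff_cutoff_mul` — `χ Q ∈ C¹(ℝ)`; `contDiff_glob` — `(t, x) ↦ χ(x) g(t, x)` is `C²(ℝ²)` when
  `g` is `C²` on `{x > a}`;
* `glob_residual` — if `g` solves the `Q`-equation on `{x > a}` (`IsSolutionAt`), then `χg` solves
  the `χQ`-equation for `x > a₂`; `glob_energyDensity` — the `χQ`-energy density of `χg` equals the
  `Q`-energy density of `g` for `x > a₂`;
* `isSolutionAt_sub_static` / `isSolutionAt_static` — subtracting `c·u` (`u'' = Qu` static) from a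
  solution gives a solution, and `(t, x) ↦ c u(x)` is one;
* `contDiffOn_sub_static`, `contDiffOn_static` — the corresponding half-plane regularity.
-/

noncomputable section

-- the doubled `FinalStateConjecture.FinalStateConjecture` path component trips dupNamespace
set_option linter.dupNamespace false

namespace Summit.FinalStateConjecture.FinalStateConjecture.Theorems.CrumPeelingRecessiveTower

open MeasureTheory Set Filter Topology Literature.Geometry.Lorentzian.ReggeWheeler

/-- **A smooth monotone cutoff between `a` and `x_f`**: for `a < x_f` there are `a < a₁ < a₂ < x_f`
and `χ ∈ C^∞(ℝ)` with `χ = 0` on `(−∞, a₁]`, `χ = 1` on `[a₂, ∞)`, `0 ≤ χ ≤ 1`. -/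
theorem exists_cutoff {a xf : ℝ} (h : a < xf) :
    ∃ (χ : ℝ → ℝ) (a₁ a₂ : ℝ), a < a₁ ∧ a₁ < a₂ ∧ a₂ < xf ∧ ContDiff ℝ 2 χ ∧
      (∀ x, x ≤ a₁ → χ x = 0) ∧ (∀ x, a₂ ≤ x → χ x = 1) ∧ (∀ x, 0 ≤ χ x) := by
  set a₁ : ℝ := a + (xf - a) / 3 with ha₁
  set a₂ : ℝ := a + 2 * (xf - a) / 3 with ha₂
  have h12 : a₁ < a₂ := by rw [ha₁, ha₂]; linarith
  refine ⟨fun x => Real.smoothTransition ((x - a₁) / (a₂ - a₁)), a₁, a₂, by rw [ha₁]; linarith,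
    h12, by rw [ha₂]; linarith, ?_, fun x hx => ?_, fun x hx => ?_, fun x => ?_⟩
  · exact Real.smoothTransition.contDiff.comp ((contDiff_id.sub contDiff_const).div_const _)
  · exact Real.smoothTransition.zero_of_nonpos
      (div_nonpos_of_nonpos_of_nonneg (by linarith) (by linarith))
  · exact Real.smoothTransition.one_of_one_le ((one_le_div (by linarith)).2 (by linarith))
  · exact Real.smoothTransition.nonneg _

section Cutoff

variable {Q : ℝ → ℝ} {χ : ℝ → ℝ} {a a₁ a₂ : ℝ} (hχ : ContDiff ℝ 2 χ)
  (hχ0 : ∀ x, x ≤ a₁ → χ x = 0) (hχ1 : ∀ x, a₂ ≤ x → χ x = 1) (ha₁ : a < a₁) (ha₂ : a₁ < a₂)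

include hχ0 ha₁ in
/-- Near a point `x ≤ a` the cutoff vanishes identically. -/
theorem cutoff_eventually_zero {x : ℝ} (hx : x ≤ a) : ∀ᶠ y in 𝓝 x, χ y = 0 :=
  Filter.mem_of_superset (Iio_mem_nhds (lt_of_le_of_lt hx ha₁)) fun y hy => hχ0 y (le_of_lt hy)

include hχ1 in
/-- Near a point `x > a₂` the cutoff is identically one. -/
theorem cutoff_eventually_one {x : ℝ} (hx : a₂ < x) : ∀ᶠ y in 𝓝 x, χ y = 1 :=
  Filter.mem_of_superset (Ioi_mem_nhds hx) fun y hy => hχ1 y (le_of_lt hy)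

include hχ hχ0 ha₁ in
/-- `χ Q ∈ C¹(ℝ)` for `Q ∈ C¹(a, ∞)`. -/
theorem contDiff_cutoff_mul (hQ : ContDiffOn ℝ 1 Q (Ioi a)) :
    ContDiff ℝ 1 (fun x => χ x * Q x) := by
  refine contDiff_iff_contDiffAt.2 fun x => ?_
  rcases lt_or_ge a x with hx | hx
  · exact ((hχ.of_le (by norm_num)).contDiffAt).mul (hQ.contDiffAt (Ioi_mem_nhds hx))
  · refine (contDiffAt_const (c := (0 : ℝ))).congr_of_eventuallyEq ?_
    exact (cutoff_eventually_zero hχ0 ha₁ hx).mono fun y hy => by simp [hy]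

include hχ hχ0 ha₁ in
/-- **Globalization is `C²`.** If `g` is `C²` on the open half-plane `{x > a}` then
`(t, x) ↦ χ(x) g(t, x)` is `C²` on `ℝ²`. -/
theorem contDiff_glob {g : ℝ → ℝ → ℝ} (hg : ContDiffOn ℝ 2 (Function.uncurry g) {z : ℝ × ℝ | a < z.2}) :
    ContDiff ℝ 2 (Function.uncurry fun t x => χ x * g t x) := by
  have hU : IsOpen {z : ℝ × ℝ | a < z.2} := isOpen_lt continuous_const continuous_snd
  refine contDiff_iff_contDiffAt.2 fun z => ?_
  rcases lt_or_ge a z.2 with hz | hz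
  · have h1 : ContDiffAt ℝ 2 (fun p : ℝ × ℝ => χ p.2) z := (hχ.comp contDiff_snd).contDiffAt
    have h2 : ContDiffAt ℝ 2 (Function.uncurry g) z := hg.contDiffAt (hU.mem_nhds hz)
    exact h1.mul h2
  · refine (contDiffAt_const (c := (0 : ℝ))).congr_of_eventuallyEq ?_
    have hmem : {p : ℝ × ℝ | p.2 < a₁} ∈ 𝓝 z :=
      (isOpen_lt continuous_snd continuous_const).mem_nhds (show z.2 < a₁ by
        exact lt_of_le_of_lt hz ha₁)
    exact Filter.mem_of_superset hmem fun p hp => by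
      show χ p.2 * g p.1 p.2 = 0
      rw [hχ0 p.2 (le_of_lt hp), zero_mul]

include hχ1 in
/-- **The globalized function solves the globalized equation on the far region.** If `g` is a
classical solution of `g_tt − g_xx + Qg = 0` at every point of `{x > a}` (`a < a₂`... only
`x > a₂` is used), then `χg` solves the equation with potential `χQ` at every `(τ, x)`, `x > a₂`. -/
theorem glob_residual {g : ℝ → ℝ → ℝ} (hsol : ∀ z : ℝ × ℝ, a₂ < z.2 → IsSolutionAt Q g z)
    (τ x : ℝ) (hx : a₂ < x) :
    iteratedDeriv 2 (fun σ => (fun t x => χ x * g t x) σ x) τ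
      - iteratedDeriv 2 ((fun t x => χ x * g t x) τ) x
      + (χ x * Q x) * (fun t x => χ x * g t x) τ x = 0 := by
  have h1 : χ x = 1 := hχ1 x hx.le
  have e1 : (fun σ => (fun t x => χ x * g t x) σ x) = fun σ => g σ x := by
    funext σ; simp [h1]
  have e2 : ((fun t x => χ x * g t x) τ) =ᶠ[𝓝 x] g τ :=
    (cutoff_eventually_one hχ1 hx).mono fun y hy => by simp [hy]
  rw [e1, e2.iteratedDeriv_eq]
  have hs := hsol (τ, x) hx
  unfold IsSolutionAt at hs
  simpa [h1] using hs

include hχ1 in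
/-- **Energy densities agree on the far region**: for `x > a₂` the `χQ`-energy density of `χg`
at `(t, x)` is the `Q`-energy density of `g`. -/
theorem glob_energyDensity (g : ℝ → ℝ → ℝ) (t x : ℝ) (hx : a₂ < x) :
    deriv (fun τ => (fun t x => χ x * g t x) τ x) t ^ 2
      + deriv ((fun t x => χ x * g t x) t) x ^ 2
      + (χ x * Q x) * (fun t x => χ x * g t x) t x ^ 2 = energyDensity Q g t x := by
  have h1 : χ x = 1 := hχ1 x hx.le
  have e1 : (fun τ => (fun t x => χ x * g t x) τ x) = fun τ => g τ x := by
    funext τ; simp [h1]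
  have e2 : ((fun t x => χ x * g t x) t) =ᶠ[𝓝 x] g t :=
    (cutoff_eventually_one hχ1 hx).mono fun y hy => by simp [hy]
  rw [e1, e2.deriv_eq]
  simp [h1, energyDensity]

end Cutoff

section Static

variable {Q : ℝ → ℝ} {a : ℝ} {u : ℝ → ℝ} {φ : ℝ → ℝ → ℝ}

/-- `iteratedDeriv 2 (c · u) = c · iteratedDeriv 2 u` (no differentiability needed over a field). -/
theorem iteratedDeriv_two_const_mul (c : ℝ) (u : ℝ → ℝ) (x : ℝ) :
    iteratedDeriv 2 (fun y => c * u y) x = c * iteratedDeriv 2 u x :=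
  iteratedDeriv_const_mul_field c u

/-- **A static solution is a solution**: if `u'' = Qu` on `(a, ∞)` then `(t, x) ↦ c u(x)` solves
`IsSolutionAt Q` at every point of `{x > a}`. -/
theorem isSolutionAt_static (hueq : ∀ x, a < x → iteratedDeriv 2 u x = Q x * u x) (c : ℝ)
    (z : ℝ × ℝ) (hz : a < z.2) : IsSolutionAt Q (fun _ x => c * u x) z := by
  unfold IsSolutionAt
  rw [iteratedDeriv_const, iteratedDeriv_two_const_mul, hueq z.2 hz]
  simp only [OfNat.ofNat_ne_zero, ↓reduceIte]
  ring

/-- Slices of a function `C²` on the open half-plane `{x > a}` are `C²` (in `t`: globally; in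
`x`: at every `x > a`). -/
theorem contDiffAt_slices (hφ : ContDiffOn ℝ 2 (Function.uncurry φ) {z : ℝ × ℝ | a < z.2})
    (t : ℝ) {x : ℝ} (hx : a < x) :
    ContDiffAt ℝ 2 (fun τ => φ τ x) t ∧ ContDiffAt ℝ 2 (φ t) x := by
  have hU : IsOpen {z : ℝ × ℝ | a < z.2} := isOpen_lt continuous_const continuous_snd
  constructor
  · have h : ContDiffAt ℝ 2 (Function.uncurry φ) (t, x) := hφ.contDiffAt (hU.mem_nhds hx)
    exact h.comp t (contDiffAt_id.prodMk contDiffAt_const)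
  · have h : ContDiffAt ℝ 2 (Function.uncurry φ) (t, x) := hφ.contDiffAt (hU.mem_nhds hx)
    exact h.comp x (contDiffAt_const.prodMk contDiffAt_id)

/-- **Subtracting a static solution**: if `φ` solves the equation on `{x > a}` and `u'' = Qu`
there (`u ∈ C²(a, ∞)`), then `φ − c u` solves it on `{x > a}`. -/
theorem isSolutionAt_sub_static (hφ : ContDiffOn ℝ 2 (Function.uncurry φ) {z : ℝ × ℝ | a < z.2})
    (hφsol : ∀ z : ℝ × ℝ, a < z.2 → IsSolutionAt Q φ z) (hu : ContDiffOn ℝ 2 u (Ioi a))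
    (hueq : ∀ x, a < x → iteratedDeriv 2 u x = Q x * u x) (c : ℝ) (z : ℝ × ℝ) (hz : a < z.2) :
    IsSolutionAt Q (fun t y => φ t y - c * u y) z := by
  obtain ⟨h1, h2⟩ := contDiffAt_slices hφ z.1 hz
  have h3 : ContDiffAt ℝ 2 (fun _ : ℝ => c * u z.2) z.1 := contDiffAt_const
  have h4 : ContDiffAt ℝ 2 (fun y => c * u y) z.2 :=
    contDiffAt_const.mul (hu.contDiffAt (Ioi_mem_nhds hz))
  have hs := hφsol z hz
  have hst := isSolutionAt_static hueq c z hz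
  unfold IsSolutionAt at hs hst ⊢
  rw [iteratedDeriv_fun_sub h1 h3, iteratedDeriv_fun_sub h2 h4]
  linarith

/-- The static function `(t, x) ↦ c u(x)` is `C²` on the half-plane `{x > a}`. -/
theorem contDiffOn_static (hu : ContDiffOn ℝ 2 u (Ioi a)) (c : ℝ) :
    ContDiffOn ℝ 2 (Function.uncurry fun (_ : ℝ) (x : ℝ) => c * u x) {z : ℝ × ℝ | a < z.2} := by
  have : (Function.uncurry fun (_ : ℝ) (x : ℝ) => c * u x) = fun z : ℝ × ℝ => c * u z.2 := by
    funext z; rfl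
  rw [this]
  exact contDiffOn_const.mul (hu.comp contDiff_snd.contDiffOn fun z hz => hz)

/-- `φ − c u` is `C²` on the half-plane `{x > a}`. -/
theorem contDiffOn_sub_static (hφ : ContDiffOn ℝ 2 (Function.uncurry φ) {z : ℝ × ℝ | a < z.2})
    (hu : ContDiffOn ℝ 2 u (Ioi a)) (c : ℝ) :
    ContDiffOn ℝ 2 (Function.uncurry fun t y => φ t y - c * u y) {z : ℝ × ℝ | a < z.2} := by
  have : (Function.uncurry fun t y => φ t y - c * u y)
      = fun z : ℝ × ℝ => Function.uncurry φ z - c * u z.2 := by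
    funext z; rfl
  rw [this]
  exact hφ.sub (contDiffOn_static hu c)

end Static

/-- Registered form of `contDiff_glob` (sub-goal `stub_kernelOneGlobalize` of the crux item). -/
theorem stub_kernelOneGlobalize : ∀ (χ : ℝ → ℝ) (a a₁ : ℝ), ContDiff ℝ 2 χ →
    (∀ x, x ≤ a₁ → χ x = 0) → a < a₁ → ∀ (g : ℝ → ℝ → ℝ),
    ContDiffOn ℝ 2 (Function.uncurry g) {z : ℝ × ℝ | a < z.2} →
    ContDiff ℝ 2 (Function.uncurry fun t x => χ x * g t x) :=
  fun _ _ _ hχ hχ0 ha₁ _ hg => contDiff_glob hχ hχ0 ha₁ hg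

end Summit.FinalStateConjecture.FinalStateConjecture.Theorems.CrumPeelingRecessiveTower
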